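import Summits.AtomisticToContinuum.HydrodynamicLimit.Theses.StiffCollisionalRelaxation
import Summits.AtomisticToContinuum.HydrodynamicLimit.Theorems.AprioriBounds.Negative.EquilibriumRung
import Summits.AtomisticToContinuum.HydrodynamicLimit.Theorems.AprioriBounds.Negative.CriticalLambda
import Summits.AtomisticToContinuum.HydrodynamicLimit.Theorems.StiffCollisionalRelaxationAprioriBoundsOfInBand
import Literature.MathematicalPhysics.KineticTheory.HardSphereEulerProofs

/-!
# Negative-side bookkeeping for the profile-uniform a-priori crux `AprioriBoundsInBand` (stmt-AtomisticToContinuum-17749)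

Crux-attack (vetting) record of refuter-rattack-stmt-AtomisticToContinuum-17749-0 (2026-08-17) for the rank-4
crux `StiffCollisionalRelaxation.AprioriBoundsInBand` = the per-profile crux `AprioriBounds` (stmt-14827) with its
dilute threshold `∃ η₁ > 0` moved OUTERMOST (before the profiles).  Everything here is the image of the landed
14827 negatives (`Theorems/AprioriBounds/Negative/EquilibriumRung.lean`, `…/CriticalLambda.lean`) under the landed
quantifier bookkeeping `FibreDeficitTransfer.aprioriBounds_of_inBand : AprioriBoundsInBand → AprioriBounds`, plus the
one structural fact that is specific to the uniform form: the body is ANTITONE in the threshold, so `η₁` may be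
taken as small as one likes (`aprioriBoundsInBand_iff_forall_small`) — the outermost `∃ η₁` is a claim of
EXISTENCE of a universal packing ceiling, never of its size, and on every non-vacuous instance it already forces
`2σ³ < η₁` (`two_mul_pow_three_lt_of_dilute_localGibbs`, 14827 file).

Findings recorded as theorems (all sorry-free, no Theses declaration asserted positively):
* `equilibriumAprioriBounds_of_inBand` — NON-VACUITY, unconditionally: the crux's prefix (classical hs-Euler
  solution + identified `t = 0` LLN + horizon + dilute clause) is discharged in the tree at the homogeneous data
  `(1, θ₀, 0)` (constant solution, `homogeneous_lln_identified`, `localGibbs_lln_holds`), so the crux implies the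
  equilibrium rung `EquilibriumAprioriBounds` ((i) ∧ (ii) for every flow family and EVERY `t > 0`); a
  counterexample to the rung refutes 17749, a proof of 17749 proves it.
* `aprioriBoundsInBandAllLambda_false` — the natural strengthening with (i)'s exponential parameter UNIVERSAL
  (`∀ λ > 0 ∃ C`) is FALSE (critical Maxwellian moment `λ = 1/(2θ₀)` along Alexander's flow at equilibrium):
  any proof must let `λ` depend on the temperature range of the data.
* `inBand_equilibrium_lambda_lt` — quantitatively, the crux's own `λ` at the data `(1, θ₀, 0)` is `< 1/(2θ₀)`.
* `aprioriBoundsInBand_iff_forall_small` — WLOG `η₁ ≤ η₀` for any prescribed `η₀ > 0`.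
-/

noncomputable section

open MeasureTheory Filter Set Topology
open scoped ENNReal

namespace Summit.AtomisticToContinuum.HydrodynamicLimit.Theorems.AprioriBoundsInBandNegative

open Literature.MathematicalPhysics.KineticTheory Literature.Analysis.FluidPDE
open Summit.AtomisticToContinuum.HydrodynamicLimit.Theses.StiffCollisionalRelaxation (AprioriBoundsInBand AprioriBounds)
open Summit.AtomisticToContinuum.HydrodynamicLimit.Theorems.AprioriBoundsNegative
open Summit.AtomisticToContinuum.HydrodynamicLimit.Theorems.FibreDeficitTransfer (aprioriBounds_of_inBand)

/-! ## §1 The body at a given threshold; antitonicity in `η₁` -/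

/-- The body of the crux at a fixed dilute threshold `η₁`: `∀ profiles ∃ σ₀ ∀ σ < σ₀ …` (i) ∧ (ii), in the
`PartOneAt` / `PartTwoAt` vocabulary of the 14827 negatives (definitionally the route text). -/
def InBandBody (η₁ : ℝ) : Prop :=
  ∀ (a₀ θ₀ : T3 → ℝ) (u₀ : T3 → V3), Continuous a₀ → Continuous θ₀ → Continuous u₀ →
    (∀ x, 0 < a₀ x) → (∀ x, 0 < θ₀ x) →
    ∃ σ₀ : ℝ, 0 < σ₀ ∧ ∀ σ : ℝ, 0 < σ → σ < σ₀ →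
      ∀ (T : ℝ) (ρ θ : ℝ → T3 → ℝ) (u : ℝ → T3 → V3), IsHardSphereEulerSolution σ T ρ u θ →
      ∀ Φ : (N : ℕ) → HardSphereFlow (Torus.geometry (Fin 3)) (hsDiameter σ N) (N + 1),
        TendstoHydroFieldsAt (fun N => localGibbsLaw σ a₀ u₀ θ₀ N (Φ N)) Φ ρ u θ 0 →
        ∀ t : ℝ, 0 < t → t < T → (∀ s ∈ Icc 0 t, ∀ x, 2 * ρ s x * σ ^ 3 < η₁) →
          PartOneAt σ a₀ θ₀ u₀ Φ t ∧ PartTwoAt σ a₀ θ₀ u₀ Φ t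

/-- The crux is `∃ η₁ > 0, InBandBody η₁` (definitional unfolding). -/
theorem aprioriBoundsInBand_iff_exists_body : AprioriBoundsInBand ↔ ∃ η₁ : ℝ, 0 < η₁ ∧ InBandBody η₁ :=
  Iff.rfl

/-- **Antitonicity in the threshold.**  A smaller `η₁` only strengthens the dilute hypothesis, so the body
descends: `η' ≤ η → InBandBody η → InBandBody η'`. -/
theorem inBandBody_anti {η η' : ℝ} (hle : η' ≤ η) (h : InBandBody η) : InBandBody η' := by
  intro a₀ θ₀ u₀ ha hθ hu ha0 hθ0
  obtain ⟨σ₀, hσ₀, H⟩ := h a₀ θ₀ u₀ ha hθ hu ha0 hθ0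
  exact ⟨σ₀, hσ₀, fun σ hσ hσ' T ρ θ u hsol Φ h0 t ht htT hdil =>
    H σ hσ hσ' T ρ θ u hsol Φ h0 t ht htT fun s hs x => (hdil s hs x).trans_le hle⟩

/-- **WLOG `η₁` is small.**  The crux is equivalent to: for EVERY prescribed ceiling `η₀ > 0` there is a
threshold `0 < η₁ ≤ η₀` at which the body holds.  (So the outermost `∃ η₁` claims the existence of SOME
profile-uniform packing ceiling below which (i)–(ii) hold pre-shock, never a ceiling of any particular size;
combined with `two_mul_pow_three_lt_of_dilute_localGibbs` every non-vacuous instance then has `2σ³ < η₁ ≤ η₀`.) -/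
theorem aprioriBoundsInBand_iff_forall_small :
    AprioriBoundsInBand ↔ ∀ η₀ : ℝ, 0 < η₀ → ∃ η₁ : ℝ, 0 < η₁ ∧ η₁ ≤ η₀ ∧ InBandBody η₁ := by
  constructor
  · rintro ⟨η₁, hη₁, H⟩ η₀ hη₀
    exact ⟨min η₁ η₀, lt_min hη₁ hη₀, min_le_right _ _, inBandBody_anti (min_le_left _ _) H⟩
  · intro h
    obtain ⟨η₁, hη₁, -, H⟩ := h 1 one_pos
    exact ⟨η₁, hη₁, H⟩

/-! ## §2 Non-vacuity: the crux implies its equilibrium rung, unconditionally -/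

/-- **17749 ⇒ the equilibrium rung.**  Through `aprioriBounds_of_inBand` (pure quantifier bookkeeping) and
`equilibriumAprioriBounds_of_aprioriBounds` (prefix discharged at the homogeneous data by the constant classical
solution and the tree's identified `t = 0` LLN): for every `θ₀ > 0` there is `σ₀ > 0` such that for all
`0 < σ < σ₀`, every flow family and every `t > 0`, (i) and (ii) hold at the data `(1, θ₀, 0)`.  In particular
the hypotheses of the crux are satisfiable in the tree (no vacuity), and this is the first typed statement any
proof of 17749 must deliver. -/
theorem equilibriumAprioriBounds_of_inBand (h : AprioriBoundsInBand) : EquilibriumAprioriBounds :=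
  equilibriumAprioriBounds_of_aprioriBounds (aprioriBounds_of_inBand h)

/-! ## §3 The `∀ λ` strengthening of the uniform crux is false -/

/-- The strengthening of `AprioriBoundsInBand` in which the exponential parameter of (i) is UNIVERSAL
(`∀ λ > 0 ∃ C`); prefix verbatim (uniform `η₁` outermost), component (ii) dropped (a weakening of what is
refuted). -/
def AprioriBoundsInBandAllLambda : Prop :=
  ∃ η₁ : ℝ, 0 < η₁ ∧ ∀ (a₀ θ₀ : T3 → ℝ) (u₀ : T3 → V3), Continuous a₀ → Continuous θ₀ → Continuous u₀ →
    (∀ x, 0 < a₀ x) → (∀ x, 0 < θ₀ x) →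
    ∃ σ₀ : ℝ, 0 < σ₀ ∧ ∀ σ : ℝ, 0 < σ → σ < σ₀ →
      ∀ (T : ℝ) (ρ θ : ℝ → T3 → ℝ) (u : ℝ → T3 → V3), IsHardSphereEulerSolution σ T ρ u θ →
      ∀ Φ : (N : ℕ) → HardSphereFlow (Torus.geometry (Fin 3)) (hsDiameter σ N) (N + 1),
        TendstoHydroFieldsAt (fun N => localGibbsLaw σ a₀ u₀ θ₀ N (Φ N)) Φ ρ u θ 0 →
        ∀ t : ℝ, 0 < t → t < T → (∀ s ∈ Icc 0 t, ∀ x, 2 * ρ s x * σ ^ 3 < η₁) →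
          ∀ lam : ℝ, 0 < lam → ∃ Cexp : ℝ,
            Tendsto (fun N : ℕ => localGibbsLaw σ a₀ u₀ θ₀ N (Φ N)
              {z | Cexp < ∫ s in Icc 0 t, ∫ y, Real.exp (lam * ‖y.2‖ ^ 2)
                ∂(empiricalMeasure ((Φ N).flow s z))}) atTop (𝓝 0)

/-- **The `∀ λ` strengthening is false** — instantiate the uniform threshold and apply the landed per-profile
refutation `aprioriBoundsAllLambda_false` (critical moment `λ = 1/(2θ₀)` at the homogeneous data `(1, 1, 0)`,
Alexander's regularised flow, flow-invariance of the Gibbs law, Markov–Tonelli).  MESSAGE for provers of 17749: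
`λ` is dictated by the data (`λ · 2 sup θ < 1` is necessary), exactly as the statement's `∃ lam` allows. -/
theorem aprioriBoundsInBandAllLambda_false : ¬ AprioriBoundsInBandAllLambda := by
  rintro ⟨η₁, hη₁, H⟩
  refine aprioriBoundsAllLambda_false fun a₀ θ₀ u₀ ha hθ hu ha0 hθ0 => ?_
  obtain ⟨σ₀, hσ₀, H'⟩ := H a₀ θ₀ u₀ ha hθ hu ha0 hθ0
  exact ⟨σ₀, hσ₀, η₁, hη₁, H'⟩

/-- **The crux's own `λ` at equilibrium data is subcritical** (unconditional; image of
`aprioriBounds_equilibrium_lambda_lt`): at the data `(1, θ₀, 0)`, for all small `σ`, along Alexander's flows and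
every horizon `t > 0`, 17749 PRODUCES a pair `(λ, C)` for (i) and that `λ` is `< 1/(2θ₀)`. -/
theorem inBand_equilibrium_lambda_lt (h : AprioriBoundsInBand) {θb : ℝ} (hθ : 0 < θb) :
    ∃ σ₀ : ℝ, 0 < σ₀ ∧ ∀ σ : ℝ, 0 < σ → σ < σ₀ →
      ∃ Φ : (N : ℕ) → HardSphereFlow (Torus.geometry (Fin 3)) (hsDiameter σ N) (N + 1),
        ∀ t : ℝ, 0 < t → ∃ lam Cexp : ℝ, 0 < lam ∧ lam < 1 / (2 * θb) ∧
          Tendsto (fun N : ℕ => localGibbsLaw σ (fun _ => 1) (fun _ => 0) (fun _ => θb) N (Φ N)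
            {z | Cexp < ∫ s in Icc 0 t, ∫ y, Real.exp (lam * ‖y.2‖ ^ 2)
              ∂(empiricalMeasure ((Φ N).flow s z))}) atTop (𝓝 0) :=
  aprioriBounds_equilibrium_lambda_lt (aprioriBounds_of_inBand h) hθ

/-! ## §4 On a non-vacuous instance the dilute clause forces `2σ³ < η₁`

Nothing to restate: the landed `AprioriBoundsNegative.two_mul_pow_three_lt_of_dilute_localGibbs`
(`Theorems/AprioriBounds/Negative/EquilibriumRung.lean`) applies verbatim to the prefix of 17749 — whenever the
prefix is in force at `(σ ≤ 1/2, T, ρ, u, θ, Φ, t)` with threshold `η₁`, then `2σ³ < η₁`; so at a uniform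
threshold only the reduced diameters `σ < (η₁/2)^{1/3}` carry content, for EVERY profile. -/

end Summit.AtomisticToContinuum.HydrodynamicLimit.Theorems.AprioriBoundsInBandNegative

end
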